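import Summits.Ventures.AbcShadow.SH02.KillData
import Literature.NumberTheory.EllipticCurves.VariableChangePoints

/-!
# Venture AbcShadow — SH-02 kernel point counting: `a_ℓ` by Euler's criterion (`ℓ = 7841, 41189`)

HONEST FRAMING. Certificate-checker file of the work-bound cell `abc-shadow` (typer seat `abc-shadow-typ-2`); no
Diophantine statement, no claim on abc or on any summit, no side on IUT. It discharges IN THE KERNEL the first half
of the COMPUTED kill-prime data of `SH02/KillData.lean`: the traces `a_7841(2336a1) = a_7841(2336b1) = −158` and
`a_41189(2336a1) = a_41189(2336b1) = −284` of the Table-3 curves of [BS23] (Cremona models `[0,0,0,−25,±48]`), where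
`a_ℓ(C) = apTrace ℓ C = ℓ + 1 − Nat.card C(𝔽_ℓ)` is the tree's definition (`SH02/BS23Package.lean`).

* `powFast` — square-and-multiply as a plain `Nat.rec` (kernel-friendly: structural recursion through `brecOn` is
  unusable under `decide +kernel` at this size), `powFast_eq : powFast a e = a ^ e`.
* `eulerChi a` — `0, 1, −1` according to `a = 0`, `a^{(ℓ−1)/2} = 1`, else; `eulerChi_eq_quadraticChar` (Mathlib's
  `quadraticChar_eq_pow_of_char_ne_two`).
* `natCard_point_eq_sum` — for a Weierstrass curve with `a₁ = a₃ = 0` and `Δ ≠ 0` over a finite field of odd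
  characteristic, `#W(F) = q + 1 + Σ_x χ(x³ + a₂x² + a₄x + a₆)` (the point at infinity, and `χ(f(x)) + 1` values of
  `y` over each `x`, Mathlib's `quadraticChar_card_sqrts`; on an elliptic curve every solution is a nonsingular
  point) — the same argument as `Literature.NumberTheory.EllipticCurves.HasseElementary.natCard_point_eq` (short
  normal form), here with `a₂` allowed since the Frey–Hellegouarch curves `G_{w,v}` have `a₂ = 2w`.
* `traceCalc ℓ W = −Σ_{i<ℓ} eulerChi(f(i))` as a `Nat.rec` loop and `apTrace_eq_traceCalc`.
* `flipNeg W = (0, −a₂, 0, a₄, −a₆)` and `natCard_flipNeg`: over a field with `i = √−1` the change of variables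
  `(x, y) ↦ (−x, iy)` (the tree's `WeierstrassCurve.VariableChange.pointEquiv`) identifies the points of `W` and
  `flipNeg W`; `2336b1 = flipNeg 2336a1` (the `−1`-twist) and `G_{−w,v} = flipNeg G_{w,v}`, so at `ℓ ≡ 1 (mod 4)` only
  one curve of the pair and one half of the `w` need a kernel run.
* KERNEL FACTS (`decide +kernel`): `traceCalc` of `2336a1` at `ℓ = 7841` (a loop of `7841` Euler criteria; the
  `ℓ = 41189` loop is `SH02/Trace41189.lean`), `√−1 = 7643` in `𝔽_7841` and `= 13634` in `𝔽_41189`, the reduced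
  discriminants are nonzero; whence `apTrace_e2336a1_7841 = apTrace_e2336b1_7841 = −158`.

References: [BS23] M. A. Bennett, S. Siksek, Algebra & Number Theory 17 (2023), Table 3 p. 1824; J. H. Silverman,
*The Arithmetic of Elliptic Curves*, V.1 (point counts via the quadratic character) — here: Mathlib.
-/

namespace Summit.Ventures.AbcShadow

open WeierstrassCurve

/-! ## Square-and-multiply as a plain recursor -/

/-- The square-and-multiply step functional, iterated `k` times by `Nat.rec` (fuel `k`), applied to the exponent `e`:
`a^e` whenever `e < 2^k`. [folklore] -/
def powFuel {M : Type} [Mul M] [One M] (a : M) (k : ℕ) : ℕ → M :=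
  Nat.rec (motive := fun _ => ℕ → M) (fun _ => 1)
    (fun _ ih e => if e = 0 then 1 else
      let h := ih (e / 2)
      if e % 2 = 0 then h * h else h * h * a) k

/-- **Fast exponentiation** `powFast a e = a ^ e` (`powFast_eq`), computed by square-and-multiply with fuel
`log₂ e + 1`; used for Euler's criterion in the kernel. [folklore] -/
def powFast {M : Type} [Mul M] [One M] (a : M) (e : ℕ) : M :=
  powFuel a (Nat.log2 e + 1) e

/-- `powFuel a k e = a ^ e` for `e < 2^k`. [folklore] -/
theorem powFuel_eq {M : Type} [Monoid M] (a : M) : ∀ (k e : ℕ), e < 2 ^ k → powFuel a k e = a ^ e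
  | 0, e, he => by
    have : e = 0 := by omega
    subst this
    exact (pow_zero a).symm
  | k + 1, e, he => by
    show (if e = 0 then 1 else
      let h := powFuel a k (e / 2)
      if e % 2 = 0 then h * h else h * h * a) = a ^ e
    by_cases h0 : e = 0
    · simp [h0]
    · rw [if_neg h0]
      have hk : e / 2 < 2 ^ k := by
        have : 2 ^ (k + 1) = 2 * 2 ^ k := by ring
        omega
      simp only [powFuel_eq a k (e / 2) hk]
      by_cases h2 : e % 2 = 0
      · rw [if_pos h2, ← pow_add]
        congr 1
        omega
      · rw [if_neg h2, ← pow_add, ← pow_succ]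
        congr 1
        omega

/-- `powFast a e = a ^ e`. [folklore] -/
theorem powFast_eq {M : Type} [Monoid M] (a : M) (e : ℕ) : powFast a e = a ^ e :=
  powFuel_eq a _ e Nat.lt_log2_self

/-! ## Euler's criterion as a computable quadratic character -/

/-- **Computable quadratic character** on `ZMod ℓ` (`ℓ` an odd prime): `0` at `0`, `1` if `a^{⌊ℓ/2⌋} = 1`, else `−1`
(Euler's criterion). Equals Mathlib's `quadraticChar (ZMod ℓ)` (`eulerChi_eq_quadraticChar`). [folklore] -/
def eulerChi {ℓ : ℕ} (a : ZMod ℓ) : ℤ :=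
  if a = 0 then 0 else if powFast a (ℓ / 2) = 1 then 1 else -1

/-- `eulerChi = quadraticChar (ZMod ℓ)` for an odd prime `ℓ` (Mathlib's `quadraticChar_eq_pow_of_char_ne_two`).
[folklore] -/
theorem eulerChi_eq_quadraticChar {ℓ : ℕ} [Fact ℓ.Prime] (hℓ2 : ℓ ≠ 2) (a : ZMod ℓ) :
    eulerChi a = quadraticChar (ZMod ℓ) a := by
  unfold eulerChi
  by_cases ha : a = 0
  · rw [if_pos ha, ha, quadraticChar_zero]
  · have hF : ringChar (ZMod ℓ) ≠ 2 := by rwa [ZMod.ringChar_zmod_n]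
    rw [if_neg ha, quadraticChar_eq_pow_of_char_ne_two hF ha, ZMod.card ℓ, powFast_eq]

/-! ## The point count of `y² = x³ + a₂x² + a₄x + a₆` over a finite field -/

/-- The right-hand side `f(x) = x³ + a₂x² + a₄x + a₆` of a Weierstrass equation with `a₁ = a₃ = 0`. [folklore] -/
def rhs {R : Type} [CommRing R] (W : WeierstrassCurve R) (x : R) : R :=
  x ^ 3 + W.a₂ * x ^ 2 + W.a₄ * x + W.a₆

/-- For `a₁ = a₃ = 0` the affine equation is `y² = f(x)`. [folklore] -/
theorem equation_iff_rhs {R : Type} [CommRing R] (W : WeierstrassCurve R) (h1 : W.a₁ = 0) (h3 : W.a₃ = 0)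
    (x y : R) : W.toAffine.Equation x y ↔ y ^ 2 = rhs W x := by
  rw [WeierstrassCurve.Affine.equation_iff, h1, h3, rhs]
  constructor <;> intro h <;> linear_combination h

/-- **Point count by the quadratic character**: for a Weierstrass curve `W` with `a₁ = a₃ = 0` and `Δ ≠ 0` over a
finite field `F` of odd characteristic with `q` elements, `#W(F) = q + 1 + Σ_{x ∈ F} χ(f(x))`, where
`#W(F) = Nat.card W.toAffine.Point` (Mathlib's nonsingular points with `O`; on an elliptic curve every solution of the
equation is nonsingular) and `χ` is the quadratic character (`#{y : y² = a} = χ(a) + 1`,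
Mathlib's `quadraticChar_card_sqrts`). [folklore] -/
theorem natCard_point_eq_sum {F : Type} [Field F] [Fintype F] [DecidableEq F] (W : WeierstrassCurve F)
    (h1 : W.a₁ = 0) (h3 : W.a₃ = 0) (hΔ : W.Δ ≠ 0) (hF : ringChar F ≠ 2) :
    (Nat.card W.toAffine.Point : ℤ) = Fintype.card F + 1 + ∑ x : F, quadraticChar F (rhs W x) := by
  classical
  have e : W.toAffine.Point ≃ Option {xy : F × F // W.toAffine.Nonsingular xy.1 xy.2} :=
    WeierstrassCurve.Affine.nonsingularPointEquiv W.toAffine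
  have e1 : {xy : F × F // W.toAffine.Nonsingular xy.1 xy.2} ≃ {xy : F × F // xy.2 ^ 2 = rhs W xy.1} := by
    refine Equiv.subtypeEquivRight fun xy => ?_
    rw [← WeierstrassCurve.Affine.equation_iff_nonsingular_of_Δ_ne_zero hΔ, equation_iff_rhs W h1 h3]
  rw [Nat.card_congr (e.trans (Equiv.optionCongr e1)), Nat.card_eq_fintype_card, Fintype.card_option,
    Fintype.card_congr (Equiv.subtypeProdEquivSigmaSubtype fun x y : F => y ^ 2 = rhs W x), Fintype.card_sigma]
  have hcount : ∀ x : F, (Fintype.card {y : F // y ^ 2 = rhs W x} : ℤ) = quadraticChar F (rhs W x) + 1 := by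
    intro x
    rw [← quadraticChar_card_sqrts hF (rhs W x), Set.toFinset_setOf, Fintype.card_subtype]
  push_cast
  rw [Finset.sum_congr rfl fun x _ => hcount x, Finset.sum_add_distrib]
  simp only [Finset.sum_const, Finset.card_univ, nsmul_eq_mul, mul_one]
  ring

/-! ## The trace as a kernel loop -/

/-- `Σ_{i < n} eulerChi(f(i))` as a plain `Nat.rec` loop. [folklore] -/
def traceLoop {ℓ : ℕ} (W : WeierstrassCurve (ZMod ℓ)) (n : ℕ) : ℤ :=
  Nat.rec (motive := fun _ => ℤ) 0 (fun i acc => acc + eulerChi (rhs W (i : ZMod ℓ))) n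

/-- **Computable trace** `traceCalc ℓ W = −Σ_{i < ℓ} eulerChi(f(i))` (`= a_ℓ(W)`, `apTrace_eq_traceCalc`). [folklore] -/
def traceCalc (ℓ : ℕ) (W : WeierstrassCurve (ZMod ℓ)) : ℤ :=
  -traceLoop W ℓ

/-- The loop is the `Finset.range` sum. [folklore] -/
theorem traceLoop_eq {ℓ : ℕ} (W : WeierstrassCurve (ZMod ℓ)) :
    ∀ n : ℕ, traceLoop W n = ∑ i ∈ Finset.range n, eulerChi (rhs W (i : ZMod ℓ))
  | 0 => by simp [traceLoop]
  | n + 1 => by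
    rw [Finset.sum_range_succ, ← traceLoop_eq W n]
    rfl

/-- A sum over `ZMod ℓ` is the sum over the residues `0, …, ℓ − 1`. [folklore] -/
theorem sum_zmod_eq_sum_range {ℓ : ℕ} [NeZero ℓ] (g : ZMod ℓ → ℤ) :
    ∑ x : ZMod ℓ, g x = ∑ i ∈ Finset.range ℓ, g (i : ZMod ℓ) := by
  have himg : (Finset.range ℓ).image (fun i : ℕ => (i : ZMod ℓ)) = Finset.univ := by
    apply Finset.eq_univ_of_forall
    intro x
    rw [Finset.mem_image]
    exact ⟨x.val, Finset.mem_range.mpr (ZMod.val_lt x), ZMod.natCast_zmod_val x⟩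
  have hinj : Set.InjOn (fun i : ℕ => (i : ZMod ℓ)) (Finset.range ℓ : Set ℕ) := by
    intro i hi j hj h
    have h' := congrArg ZMod.val h
    simp only at h'
    rwa [ZMod.val_natCast_of_lt (Finset.mem_range.mp (Finset.mem_coe.mp hi)),
      ZMod.val_natCast_of_lt (Finset.mem_range.mp (Finset.mem_coe.mp hj))] at h'
  rw [← himg, Finset.sum_image hinj]

/-- **`a_ℓ(W) = traceCalc ℓ W`** for a Weierstrass curve `W` over `ZMod ℓ` (`ℓ` an odd prime) with `a₁ = a₃ = 0` and
`Δ ≠ 0`: the tree's `apTrace` (point count) equals the kernel loop of Euler criteria. [folklore] -/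
theorem apTrace_eq_traceCalc {ℓ : ℕ} [Fact ℓ.Prime] (hℓ2 : ℓ ≠ 2) (W : WeierstrassCurve (ZMod ℓ))
    (h1 : W.a₁ = 0) (h3 : W.a₃ = 0) (hΔ : W.Δ ≠ 0) : apTrace ℓ W = traceCalc ℓ W := by
  have hF : ringChar (ZMod ℓ) ≠ 2 := by rwa [ZMod.ringChar_zmod_n]
  haveI : NeZero ℓ := ⟨(Fact.out : ℓ.Prime).ne_zero⟩
  have hS : ∑ i ∈ Finset.range ℓ, eulerChi (rhs W (i : ZMod ℓ)) =
      ∑ i ∈ Finset.range ℓ, quadraticChar (ZMod ℓ) (rhs W (i : ZMod ℓ)) :=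
    Finset.sum_congr rfl fun i _ => eulerChi_eq_quadraticChar hℓ2 _
  rw [apTrace, natCard_point_eq_sum W h1 h3 hΔ hF, ZMod.card ℓ, traceCalc, traceLoop_eq, hS,
    ← sum_zmod_eq_sum_range (fun x => quadraticChar (ZMod ℓ) (rhs W x))]
  ring

/-! ## The `−1`-twist / `x ↦ −x` symmetry -/

/-- `flipNeg W = (0, −a₂, 0, a₄, −a₆)`: for `W = (0, a₂, 0, a₄, a₆)` the curve obtained by `(x, y) ↦ (−x, iy)`,
`i = √−1` (e.g. the `−1`-twist `2336b1` of `2336a1`, or `G_{−w,v}` from `G_{w,v}`). [folklore] -/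
def flipNeg {R : Type} [CommRing R] (W : WeierstrassCurve R) : WeierstrassCurve R :=
  { a₁ := 0, a₂ := -W.a₂, a₃ := 0, a₄ := W.a₄, a₆ := -W.a₆ }

/-- **`#flipNeg W (F) = #W(F)`** when `a₁ = a₃ = 0` and `F` contains `i` with `i² = −1`: `flipNeg W = C • W` for
Mathlib's change of variables `C = (u, r, s, t) = (i, 0, 0, 0)`, and the tree's
`WeierstrassCurve.VariableChange.pointEquiv` is a bijection of point groups. [folklore] -/
theorem natCard_flipNeg {F : Type} [Field F] [DecidableEq F] (W : WeierstrassCurve F) (h1 : W.a₁ = 0)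
    (h3 : W.a₃ = 0) (i : F) (hi : i ^ 2 = -1) :
    Nat.card (flipNeg W).toAffine.Point = Nat.card W.toAffine.Point := by
  have hi0 : i * -i = 1 := by linear_combination -hi
  let u : Fˣ := ⟨i, -i, hi0, by rw [mul_comm]; exact hi0⟩
  let C : WeierstrassCurve.VariableChange F := ⟨u, 0, 0, 0⟩
  have hu : ((C.u⁻¹ : Fˣ) : F) = -i := rfl
  have h2 : (-i) ^ 2 = -1 := by rw [neg_sq, hi]
  have h4 : (-i) ^ 4 = 1 := by
    rw [show (4 : ℕ) = 2 * 2 from rfl, pow_mul, h2]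
    norm_num
  have h6 : (-i) ^ 6 = -1 := by
    rw [show (6 : ℕ) = 2 * 3 from rfl, pow_mul, h2]
    norm_num
  have hC : C • W = flipNeg W := by
    ext
    · rw [WeierstrassCurve.variableChange_a₁, hu, h1]
      simp [flipNeg, C]
    · rw [WeierstrassCurve.variableChange_a₂, hu, h1]
      simp only [flipNeg, C, h2]
      ring
    · rw [WeierstrassCurve.variableChange_a₃, hu, h1, h3]
      simp [flipNeg, C]
    · rw [WeierstrassCurve.variableChange_a₄, hu, h1, h3]
      simp only [flipNeg, C, h4]
      ring
    · rw [WeierstrassCurve.variableChange_a₆, hu, h1, h3]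
      simp only [flipNeg, C, h6]
      ring
  rw [← hC]
  exact (Nat.card_congr (WeierstrassCurve.VariableChange.pointEquiv W C).toEquiv).symm

/-- Hence equal traces: `a_ℓ(flipNeg W) = a_ℓ(W)` (given `√−1 ∈ 𝔽_ℓ`, i.e. `ℓ ≡ 1 (mod 4)`). [folklore] -/
theorem apTrace_flipNeg {ℓ : ℕ} [Fact ℓ.Prime] (W : WeierstrassCurve (ZMod ℓ)) (h1 : W.a₁ = 0) (h3 : W.a₃ = 0)
    (i : ZMod ℓ) (hi : i ^ 2 = -1) : apTrace ℓ (flipNeg W) = apTrace ℓ W := by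
  unfold apTrace
  rw [natCard_flipNeg W h1 h3 i hi]

/-- `2336b1 mod ℓ = flipNeg (2336a1 mod ℓ)` (`[0,0,0,−25,−48]` vs `[0,0,0,−25,48]`). [folklore] -/
theorem reduceMod_e2336b1 (ℓ : ℕ) : reduceMod ℓ e2336b1 = flipNeg (reduceMod ℓ e2336a1) := by
  ext <;> simp [reduceMod, flipNeg, e2336a1, e2336b1, WeierstrassCurve.map]

/-! ## Kernel facts at `ℓ = 7841` (and the square roots of `−1`) -/

/-- Kernel evaluation: `−Σ_{x mod 7841} χ(x³ − 25x + 48) = −158`. [folklore] -/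
theorem traceCalc_e2336a1_7841 : traceCalc 7841 (reduceMod 7841 e2336a1) = -158 := by
  decide +kernel

/-- `√−1` in `𝔽_7841`: `7643² = −1` (kernel). [folklore] -/
theorem sqrtNegOne_7841 : (7643 : ZMod 7841) ^ 2 = -1 := by
  decide +kernel

/-- `√−1` in `𝔽_41189`: `13634² = −1` (kernel). [folklore] -/
theorem sqrtNegOne_41189 : (13634 : ZMod 41189) ^ 2 = -1 := by
  decide +kernel

/-- The discriminant of `2336a1` is nonzero mod `7841` and mod `41189` (good reduction; `2336 = 2⁵·73`). [folklore] -/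
theorem delta_e2336a1_ne_zero :
    (reduceMod 7841 e2336a1).Δ ≠ 0 ∧ (reduceMod 41189 e2336a1).Δ ≠ 0 := by
  constructor <;> decide +kernel

/-- **`a_7841(2336a1) = −158`** (kernel-checked point count; the record's value, inv-6 K4-73 / crit-1 j319553).
[folklore] -/
theorem apTrace_e2336a1_7841 : apTrace 7841 (reduceMod 7841 e2336a1) = -158 := by
  haveI : Fact (Nat.Prime 7841) := ⟨prime_7841⟩
  rw [apTrace_eq_traceCalc (by decide) _ rfl rfl delta_e2336a1_ne_zero.1, traceCalc_e2336a1_7841]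

/-- **`a_7841(2336b1) = −158`** (the `−1`-twist has the same trace at `ℓ ≡ 1 (mod 4)`). [folklore] -/
theorem apTrace_e2336b1_7841 : apTrace 7841 (reduceMod 7841 e2336b1) = -158 := by
  haveI : Fact (Nat.Prime 7841) := ⟨prime_7841⟩
  rw [reduceMod_e2336b1, apTrace_flipNeg _ rfl rfl 7643 sqrtNegOne_7841, apTrace_e2336a1_7841]

end Summit.Ventures.AbcShadow
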